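import Mathlib

/-!
# Graded commutativity of the cup product of 1-cocycles, up to an explicit coboundary

Solo-informed programme (Langlands / W4 Eisenstein corner), session 24, §7.11 (16.11)(g)(★7), LEMMA (Alt):
for 1-cocycles `b : G → B`, `b' : G → B'` and an equivariant pairing `Φ : B → B' → C`, the cup products
`(b ∪ b')(σ,τ) = Φ (b σ) (σ • b' τ)` and the swapped `(b' ∪ b)(σ,τ) = Φ (σ • b τ) (b' σ)` satisfy
`b ∪ b' + s(b' ∪ b) = -d m` with the 1-cochain `m σ = Φ (b σ) (b' σ)`, where
`(d m)(σ,τ) = σ • m τ - m (σ * τ) + m σ`.  This is the cochain identity that makes the Poitou–Tate triple form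
`τ(a; b, b') = ⟨a ∪ b, b'⟩` alternating on locally trivial classes.  Pure algebra: no cohomology library is used.
-/

namespace Summit.Langlands.Langlands.Theorems

/-- Cup product of two 1-cocycles plus the swapped cup product is minus the coboundary of the pointwise product. -/
theorem soloInformed_cup_swap_coboundary
    {G B B' C : Type*} [Monoid G] [AddCommGroup B] [AddCommGroup B'] [AddCommGroup C]
    [DistribMulAction G B] [DistribMulAction G B'] [DistribMulAction G C]
    (Φ : B →+ B' →+ C) (hΦ : ∀ (σ : G) (x : B) (y : B'), Φ (σ • x) (σ • y) = σ • Φ x y)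
    (b : G → B) (b' : G → B')
    (hb : ∀ σ τ : G, b (σ * τ) = b σ + σ • b τ) (hb' : ∀ σ τ : G, b' (σ * τ) = b' σ + σ • b' τ)
    (σ τ : G) :
    Φ (b σ) (σ • b' τ) + Φ (σ • b τ) (b' σ)
      = -(σ • Φ (b τ) (b' τ) - Φ (b (σ * τ)) (b' (σ * τ)) + Φ (b σ) (b' σ)) := by
  simp only [hb, hb', map_add, AddMonoidHom.add_apply, hΦ]
  abel

/-- The same identity read as: the symmetrised cup product is a coboundary (pointwise form). -/
theorem soloInformed_cup_swap_coboundary'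
    {G B B' C : Type*} [Monoid G] [AddCommGroup B] [AddCommGroup B'] [AddCommGroup C]
    [DistribMulAction G B] [DistribMulAction G B'] [DistribMulAction G C]
    (Φ : B →+ B' →+ C) (hΦ : ∀ (σ : G) (x : B) (y : B'), Φ (σ • x) (σ • y) = σ • Φ x y)
    (b : G → B) (b' : G → B')
    (hb : ∀ σ τ : G, b (σ * τ) = b σ + σ • b τ) (hb' : ∀ σ τ : G, b' (σ * τ) = b' σ + σ • b' τ)
    (σ τ : G) :
    Φ (b σ) (σ • b' τ) + Φ (σ • b τ) (b' σ)
      + (σ • Φ (b τ) (b' τ) - Φ (b (σ * τ)) (b' (σ * τ)) + Φ (b σ) (b' σ)) = 0 := by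
  rw [soloInformed_cup_swap_coboundary Φ hΦ b b' hb hb' σ τ]
  abel

/-- Local ingredient of (Alt): for 0-cochains `β ∈ B`, `β' ∈ B'` with coboundaries `dβ(σ) = σ • β - β`,
the symmetrised product `β ∪ dβ' + s(β' ∪ dβ)` equals `d(β ⊗ β')` minus the pointwise product `dβ · dβ'`. -/
theorem soloInformed_cup_swap_zero_cochains
    {G B B' C : Type*} [Monoid G] [AddCommGroup B] [AddCommGroup B'] [AddCommGroup C]
    [DistribMulAction G B] [DistribMulAction G B'] [DistribMulAction G C]
    (Φ : B →+ B' →+ C) (hΦ : ∀ (σ : G) (x : B) (y : B'), Φ (σ • x) (σ • y) = σ • Φ x y)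
    (β : B) (β' : B') (σ : G) :
    Φ β (σ • β' - β') + Φ (σ • β - β) β'
      = (σ • Φ β β' - Φ β β') - Φ (σ • β - β) (σ • β' - β') := by
  rw [← hΦ]
  simp only [map_sub, AddMonoidHom.sub_apply]
  abel

end Summit.Langlands.Langlands.Theorems
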